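import Summits.BirchSwinnertonDyer.Rank1Residual.X11b.ShapiroPairs
import HarnessLib

/-!
# BSD rank-≤1 residual cell, class X7/X8 (good SUPERSINGULAR at `p = 5`), mod-5 image `5Nn` (order 48, prime to 5):
# `BSD(E,5)` per pair (`r_an ≤ 1`, `N < 5·10⁵`) from PUBLISHED theorems + ONE full-`5`-descent certificate line — batch 12

HONEST FRAMING (cell `b2b-bsdres-*`, verbatim): prove what is provable now; shrink each hard class
to its core with data; no claim beyond stated classes; COMBINATION classes deleted from PUBLISHED
theorems only, CONSTRUCTION-shaped remainder typed; this is not "finishing BSD". The class stays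
CONSTRUCTION-SHAPED; everything here is PER PAIR; no lane verdict is changed; no named fact; nothing
is booked by this unit (x11c runs the engines; the owners / the lane decide).

Unit `b2b-bsdres-x11c` GEN 14 engines and jobs; rows folded and filed by GEN 15 (prover-b2b-bsdres-x11c-g15-0), GEN 16 (prover-b2b-bsdres-x11c-g16-0) and GEN 17 (prover-b2b-bsdres-x11c-g17-0). Universe: ALL curves of Cremona's table with Sutherland image code `5Nn` at 5
(table `HOME/b2b-bsdres-x11c/gen14/NN5-TABLE.md`); this file = rows of the lane's X4 residue (hyp `x4cap500k`) resp. the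
good-supersingular rows, with rank ≤ 1 and `dim Fake(E) = rank` (good-supersingular kind). METHOD (`gen13/S4DESCENT-METHOD.md` +
`gen14/X5DESC-METHOD.md` §1): the image `5Nn` has order 48, PRIME TO 5, and acts transitively on `E[5]∖0`, so the étale
algebra is ONE field `R = ℚ(T')` of degree 24 with `Aut(R) ≅ C₄` (scalars) and subfield degrees `{1,2,3,4,6,8,12,24}`
(ENFORCED per curve: the pattern characterises the image among the transitive subgroups `5Nn`/`5S4`/`GL₂(𝔽₅)`); MASCHKE
makes the Weil-pairing Kummer map `w_*` injective and gives `w_*Sel⁵ ⊂ Fake`, `dim Fake − dim Sel⁵ ≤ dim K_S(R)`; the rows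
here have `dim Fake = rank`, hence `#Sel^(5)(E/ℚ) = 5^{rank}` exactly, GRH-conditionally for the class group of `R`
unless the row says EXACT(Zimmert). Engine `HOME/code/b2b-bsdres-x11c/gen14/x5desc/`; jobs: kit j113025–j113037, j116841–j116889 (GEN 14), j126243 (GEN 16 mop-up), j135355–j135358 (GEN 16 mop-up 2, timed out), j150785/j150790/j150792/j150793 (GEN 17 mop-up 3, 40 GB / 48 h).

What enters the kernel per pair is ONE line: `hSel : #Sel^(5)(E/ℚ) = 5 ^ r_an` of the tree's class-free consumer
`Typed.bsdp_of_card_selmerGroup_eq_pow_analyticRank` through x11c gen 12's `X11b.bsdp_of_ainvs_of_card_selmerGroup`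
(GZK `hGZK`, `r_an ≤ 1`, `p ∤ #Ш_an`; `Δ ≠ 0` by `decide`). Non-kernel inputs per pair: `r_an`, `#Ш_an` (Cremona; the
cell's engines) and the certificate line (GRH as stated). References: Schaefer–Stoll, Trans. AMS 356 (2004); Silverman,
*AEC* X.1, X.4 [SilvermanAEC2009]; Sutherland, Forum Math. Sigma 4 (2016); Miller, LMS JCM 14 (2011) §1 [Miller2011LMS];
Cremona's tables [Cremona2006].
-/

set_option autoImplicit false

noncomputable section

open scoped Classical

open WeierstrassCurve Literature.NumberTheory.EllipticCurves
  Literature.NumberTheory.EllipticCurves.Rank1Residual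
  Literature.NumberTheory.EllipticCurves.Rank1Residual.Typed
  Literature.NumberTheory.EllipticCurves.Rank1Residual.X11RankOneCertificates
  Summit.BirchSwinnertonDyer.Rank1Residual.X11b

namespace Summit.BirchSwinnertonDyer.Rank1Residual.Supersingular

/-- **`BSD(E,5)` for `484416et1`** [GRH] (`N = 484416`, good supersingular at `5`; Cremona model `[0, 0, 0, -10445220, -27167199768]`; `ρ̄_{E,5}` = `5Nn`; rank `1`, generator `(10604935361481397864086286269/1804139936671220016888721, 820118945446538281606270584098491487568309/2423289666219746741231969527952451769)`)
from GZK and the certificate line `#Sel^(5)(E/ℚ) = 5 ^ r_an`: full `5`-descent (x11c engine, Maschke at `|G| = 48`,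
kit j150793) in `R = ℚ(T')`, `[R:ℚ] = 24`, `|d_R| ≈ 10^55`, subfield degrees `{1,2,3,4,6,8,12,24}`, `S = {2, 3, 5, 29}`, `Cl(R) = [32, [2, 2, 2, 2, 2]]` (GRH),
`25` generators of `R(S,5)` (`5`-saturated: `[1, 87, 25]`), `δ`-eigenspace of dimension `3`, `K_S(R) = 0`, all local targets
reached, Galois action PROVED by characters, **`dim Fake(E) = 1 = rank`** ⟹ **`#Sel^(5)(E/ℚ) = 5^1`**. Kernel: `Δ ≠ 0`.
Binders: `hGZK`, `r_an ≤ 1`, `#Ш_an` a `5`-unit, `hSel`.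
[cite: Miller2011LMS, §1 and Def. 1.1] [cite: Cremona2006, Table 1 (Cremona label 484416et1)] -/
theorem bsdp_s484416et1 (hGZK : rank_eq_analyticRank_of_analyticRank_le_one)
    (W : WeierstrassCurve ℚ) (hW : W = ⟨0, 0, 0, -10445220, -27167199768⟩)
    (hr : W.analyticRank ≤ 1) {q : ℚ} (hq : shaAn W = (q : ℂ)) (hv : padicValRat 5 q = 0)
    (hSel : Nat.card (W.selmerGroup (5 : ℤ)) = 5 ^ W.analyticRank) : BSDp W 5 := by
  subst hW
  haveI : Fact (Nat.Prime 5) := ⟨by norm_num⟩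
  exact bsdp_of_ainvs_of_card_selmerGroup hGZK 0 0 0 (-10445220) (-27167199768) (by decide +kernel) 5 hr hq hv hSel

end Summit.BirchSwinnertonDyer.Rank1Residual.Supersingular

end
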